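import Summits.QuantumFields.YangMills.Theorems.BalabanUVNodesN15BackgroundV1GaugeByName
import HarnessLib

/-!
# Route «BalabanUVNodes» (K4 «SpineRates»), node N15 = NE2, BACKGROUND LAYER — `V′₁(A)` WITH THE COARSE TRIPLE DERIVED FROM THE MEAN FIELD:
# the block-translation law `π ∘ (s′_μ)^N = s_μ ∘ π` makes `Ā(· − e_μ)` the block mean of `A′(· − N e′_μ)` and `∇*Ā` the block mean of the AVERAGED fine
# backward quotients; telescoping the C² letters bounds both against the means of the fine triple by `(2+|J|)·cMα₀·η`, so V1b's three perturbation letters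
# hold with the coarse coefficients of `V′₁` taken AT THE DERIVED TRIPLE OF `Ā = gavgM π A′` (the pairing's own coarse configuration) — g3's caveat removed

Cell `pub-ymgap`, seat `pub-ymgap-dag-n15-c` (generation g4; R134 ACCELERATION SEAT, strategy s1 «background-layer OPERATOR ingredient»; HUMAN RULING D-0062; chair
R424 venue; `bears_on: R4∕N15`).  Filed `--supports stmt-QuantumFields-19912 --as helper` (K3‴ `SpineGivenEndpointR13`; KEY TABLE WORDS-133; helper, count-neutral).
THEOREMS ONLY (0 `def`); imports BY NAME, nothing in the tree modified: this seat's g3 `…N15BackgroundV1GaugeByName` (`v1GaugeBg`, **`reg335_fields_of_gauge`**),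
g2 V1b∕V1c (`v1Bg`, `v1fieldsOfGauge`, `v1avg`, `v1coefC`, `v1coefA`, `rowSum_v1coefC_le`, `rowSum_v1coefA_le`, `rowFit_v1coefC`, `rowFit_v1coefA`), g1
(`gavgM`, `blockAvgV`, `fit_blockAvgV`, `norm_blockAvgV_le`), g0 (`unstackM`, `hasMaj_unstackM`, `hasMaj_idef_unstackM`, `blkPair`, `liftPair`).

WHY.  In g2∕g3's `V′₁(A)` species the COARSE coefficients sit at the fibrewise MEAN OF THE FINE TRIPLE `v1avg π (A′, A′∘s′⁻¹, ∇′*A′)`, whereas the pairing's coarse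
configuration is `Ā = gavgM π A′` and the print's coarse `V′₁` is built from the coarse lattice's OWN triple `(Ā, Ā∘s⁻¹, ∇*Ā)` (coarse shifts, spacing `η = Nη′`):
`mean(A′∘s′⁻¹) = Ā∘(one FINE step) ≠ Ā∘s⁻¹ = Ā∘(N fine steps)` and `mean(∇′*A′) ≠ ∇*Ā`.  Under the BLOCK-TRANSLATION LAW (King's cubes, `N = L^m`, sequel) the gap
telescopes into first∕second differences of `A′`, `≤ (2+|J|)·cMα₀·η` — inside the (3.35) fit tolerance `c′Mα₀θ` once `(2+|J|)c ≤ c′`, `η ≤ θ`.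

CONTENTS (namespace `…N15.BackgroundLayer`).
* §1 block means: `blockAvgV_sub'`, `blockAvgV_smul'`, `blockAvgV_finsum` (linearity); `sum_fibre_translate`, **`blockAvgV_translate`** (`blockAvgV a (σ⁻¹y) =
  blockAvgV (a∘T⁻¹) y` under `π∘T = σ∘π`); `norm_powSymm_sub_le` (`‖f((σ′^n)⁻¹x′) − f x′‖ ≤ nβ`), `norm_powSymm_sub_nsmul_le` (`‖(f x′ − f((σ′^n)⁻¹x′)) − n•D x′‖ ≤ n²β₂`
  for the backward difference `D = f − f∘σ′⁻¹` with per-step variation `β₂`); `r₂_aux` (private numeric bookkeeping).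
* §2 the coarse triple `v1fieldsOfGauge s η (gavgM π A′)` against `v1avg π (v1fieldsOfGauge s′ η′ A′)`: (component 1 `Ā` IS the mean of `A′`), **`v1C_snd_sub_le`**
  (`≤ (N+1)rη′`), **`v1C_div_sub_le`** (`≤ |J|·rη`), `v1C_sup_snd_le`, `v1C_sup_div_le` (`≤ |J|r`).
* §3 ★ **`v1C_letters_of_gauge`**: V1b's five outputs (`0 ≤ r₂ ≤ …`, coarse majorant, fine majorant, diagonal η-defect `diagK(r₂θ(1+|J⊕J|))`) for the pair (fine
  coefficients at the derived triple of `A′`, COARSE COEFFICIENTS AT THE DERIVED TRIPLE OF `Ā`), `r₂ = 16e(1+|J|)κ_e·(2c′)Mα₀`, from the C² letters of `A′` at `c`,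
  commuting shifts, `C_π`-step-connected fibres, the block-translation law, `η = Nη′`, `(2+|J|)c ≤ c′`, `(1+|J|)C_π c η′ ≤ c′θ`, and the guard `4c′a₀ ≤ 1`.

HONEST FRAMING ∕ LIMITS.  Letters only (the node theorem and the vector-piece knit are the sequel files); transport = fibrewise mean (linearised (C3)); `U ≡ 1` shapes
of (3.52); crude constants (`2c′`).  NE2⁺ NOT PRINTED; count-neutral (typed 28∕28 · discharged unchanged); NOT a discharge of N15; one finite lattice at fixed ε — NOT
infinite volume, NOT OS on ℝ⁴, NOT a mass gap, NOT Clay.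
-/

noncomputable section
open scoped BigOperators

namespace Summit.QuantumFields.YangMills.BalabanUVNodes.N15.BackgroundLayer

open Literature.MathematicalPhysics.QuantumFieldTheory.Balaban1983to89
open Literature.MathematicalPhysics.QuantumFieldTheory.Balaban1983to89.B11SectG (BlockNorm HasMaj)
open Literature.MathematicalPhysics.QuantumFieldTheory.Balaban1983to89.T4EtaRateDefect (idef)
open Literature.MathematicalPhysics.QuantumFieldTheory.Balaban1983to89.T4EtaRateCoeffDefect (pull diagK fibre mem_fibre)
open Summit.QuantumFields.YangMills.BalabanUVNodes.N15.MatrixSpecies (liftMap liftBlk basisConst basisConst_nonneg blockAvgV fit_blockAvgV norm_blockAvgV_le)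

/-! ## §1 Block means: linearity, the block-translation law, telescoping -/

section BlockMean

variable {X X' : Type} [Fintype X'] [DecidableEq X] {E : Type} [NormedAddCommGroup E] [NormedSpace ℝ E]

/-- The block mean is additive: mean of a difference. [folklore] -/
theorem blockAvgV_sub' (π : X' → X) (a b : X' → E) (x : X) :
    blockAvgV π (fun x' => a x' - b x') x = blockAvgV π a x - blockAvgV π b x := by
  simp only [blockAvgV, Finset.sum_sub_distrib, smul_sub]

/-- The block mean commutes with scalars. [folklore] -/
theorem blockAvgV_smul' (π : X' → X) (c : ℝ) (a : X' → E) (x : X) :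
    blockAvgV π (fun x' => c • a x') x = c • blockAvgV π a x := by
  simp only [blockAvgV, ← Finset.smul_sum]
  rw [smul_comm]

/-- The block mean commutes with finite sums of fields. [folklore] -/
theorem blockAvgV_finsum {J : Type} [Fintype J] (π : X' → X) (a : J → X' → E) (x : X) :
    blockAvgV π (fun x' => ∑ μ, a μ x') x = ∑ μ, blockAvgV π (a μ) x := by
  simp only [blockAvgV, Finset.smul_sum]
  rw [Finset.sum_comm]

omit [NormedSpace ℝ E] in
/-- THE BLOCK-TRANSLATION LAW ON FIBRES: if `π ∘ T = σ ∘ π` then summing over the fibre of `σ⁻¹y` is summing `f ∘ T⁻¹` over the fibre of `y`. [folklore] -/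
theorem sum_fibre_translate (π : X' → X) (T : X' ≃ X') (σ : X ≃ X) (hblk : ∀ x', π (T x') = σ (π x')) (f : X' → E) (y : X) :
    ∑ x' ∈ fibre π (σ.symm y), f x' = ∑ x' ∈ fibre π y, f (T.symm x') := by
  classical
  simp only [fibre, Finset.sum_filter]
  rw [← Equiv.sum_comp T (fun x' => if π x' = y then f (T.symm x') else 0)]
  refine Finset.sum_congr rfl fun z _ => ?_
  simp only [hblk, Equiv.symm_apply_apply]
  by_cases h : σ (π z) = y
  · rw [if_pos h, if_pos ((Equiv.eq_symm_apply σ).2 h)]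
  · rw [if_neg h, if_neg (fun h' => h ((Equiv.eq_symm_apply σ).1 h'))]

/-- **THE BLOCK-TRANSLATION LAW FOR BLOCK MEANS**: `blockAvgV a (σ⁻¹ y) = blockAvgV (a ∘ T⁻¹) y` when `π ∘ T = σ ∘ π` (coarse shift of the mean = mean of the
fine field shifted by `T`). [folklore] -/
theorem blockAvgV_translate (π : X' → X) (T : X' ≃ X') (σ : X ≃ X) (hblk : ∀ x', π (T x') = σ (π x')) (a : X' → E) (y : X) :
    blockAvgV π a (σ.symm y) = blockAvgV π (fun x' => a (T.symm x')) y := by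
  have hc : ((fibre π (σ.symm y)).card : ℝ) = (fibre π y).card := by
    rw [Finset.cast_card, Finset.cast_card, sum_fibre_translate π T σ hblk (fun _ => (1 : ℝ)) y]
  rw [blockAvgV, blockAvgV, hc, sum_fibre_translate π T σ hblk a y]

omit [Fintype X'] [DecidableEq X] [NormedSpace ℝ E] in
/-- TELESCOPING, FIRST ORDER: a per-step bound `‖f(σ′⁻¹z) − f z‖ ≤ β` gives `‖f((σ′^n)⁻¹x′) − f x′‖ ≤ n·β`. [folklore] -/
theorem norm_powSymm_sub_le (σ' : X' ≃ X') {f : X' → E} {β : ℝ} (h : ∀ z, ‖f (σ'.symm z) - f z‖ ≤ β) :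
    ∀ (n : ℕ) (x' : X'), ‖f ((σ' ^ n).symm x') - f x'‖ ≤ n * β := by
  intro n
  induction n with
  | zero =>
      intro x'
      rw [pow_zero, show (1 : X' ≃ X').symm x' = x' from rfl]
      simp
  | succ n ih =>
      intro x'
      have hstep : (σ' ^ (n + 1)).symm x' = (σ' ^ n).symm (σ'.symm x') := by
        rw [pow_succ', Equiv.Perm.mul_def, Equiv.symm_trans_apply]
      rw [hstep]
      calc ‖f ((σ' ^ n).symm (σ'.symm x')) - f x'‖
          ≤ ‖f ((σ' ^ n).symm (σ'.symm x')) - f (σ'.symm x')‖ + ‖f (σ'.symm x') - f x'‖ := norm_sub_le_norm_sub_add_norm_sub _ _ _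
        _ ≤ n * β + β := add_le_add (ih _) (h _)
        _ = (n + 1 : ℕ) * β := by push_cast; ring

omit [Fintype X'] [DecidableEq X] in
/-- TELESCOPING, SECOND ORDER: with the backward difference `D z = f z − f(σ′⁻¹z)` and a per-step bound `‖D z − D(σ′⁻¹z)‖ ≤ β₂` on ITS variation,
`‖(f x′ − f((σ′^n)⁻¹x′)) − n•D x′‖ ≤ n²·β₂` (the sum of `n` backward differences along the orbit against `n` copies of the first one). [folklore] -/
theorem norm_powSymm_sub_nsmul_le (σ' : X' ≃ X') {f : X' → E} {β₂ : ℝ} (hβ₂ : 0 ≤ β₂)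
    (h : ∀ z, ‖(f z - f (σ'.symm z)) - (f (σ'.symm z) - f (σ'.symm (σ'.symm z)))‖ ≤ β₂) :
    ∀ (n : ℕ) (x' : X'), ‖(f x' - f ((σ' ^ n).symm x')) - (n : ℝ) • (f x' - f (σ'.symm x'))‖ ≤ (n : ℝ) * n * β₂ := by
  -- the backward difference varies by `≤ k β₂` along `k` steps
  have hD : ∀ (k : ℕ) (z : X'), ‖(f ((σ' ^ k).symm z) - f (σ'.symm ((σ' ^ k).symm z))) - (f z - f (σ'.symm z))‖ ≤ k * β₂ :=
    norm_powSymm_sub_le σ' (f := fun z => f z - f (σ'.symm z)) (β := β₂) fun z => by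
      calc ‖(f (σ'.symm z) - f (σ'.symm (σ'.symm z))) - (f z - f (σ'.symm z))‖
          = ‖(f z - f (σ'.symm z)) - (f (σ'.symm z) - f (σ'.symm (σ'.symm z)))‖ := by rw [← norm_neg]; congr 1; abel
        _ ≤ β₂ := h z
  intro n
  induction n with
  | zero =>
      intro x'
      rw [pow_zero, show (1 : X' ≃ X').symm x' = x' from rfl]
      simp
  | succ n ih =>
      intro x'
      have hstep : (σ' ^ (n + 1)).symm x' = σ'.symm ((σ' ^ n).symm x') := by
        rw [pow_succ, Equiv.Perm.mul_def, Equiv.symm_trans_apply]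
      rw [hstep]
      have hsplit : (f x' - f (σ'.symm ((σ' ^ n).symm x'))) - ((n + 1 : ℕ) : ℝ) • (f x' - f (σ'.symm x')) =
          ((f x' - f ((σ' ^ n).symm x')) - (n : ℝ) • (f x' - f (σ'.symm x'))) +
            ((f ((σ' ^ n).symm x') - f (σ'.symm ((σ' ^ n).symm x'))) - (f x' - f (σ'.symm x'))) := by
        push_cast; rw [add_smul, one_smul]; abel
      rw [hsplit]
      refine (norm_add_le _ _).trans ?_
      calc ‖(f x' - f ((σ' ^ n).symm x')) - (n : ℝ) • (f x' - f (σ'.symm x'))‖ +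
            ‖(f ((σ' ^ n).symm x') - f (σ'.symm ((σ' ^ n).symm x'))) - (f x' - f (σ'.symm x'))‖
          ≤ (n : ℝ) * n * β₂ + n * β₂ := add_le_add (ih _) (hD n _)
        _ ≤ ((n + 1 : ℕ) : ℝ) * ((n + 1 : ℕ) : ℝ) * β₂ := by
            push_cast; nlinarith [mul_nonneg (Nat.cast_nonneg n : (0 : ℝ) ≤ n) hβ₂]

end BlockMean

/-! ## §2 The coarse triple of the mean field against the mean of the fine triple -/

section Triple

variable {X X' J : Type} [Fintype X'] [DecidableEq X] [Fintype J] (𝔄 : Type) [NormedAddCommGroup 𝔄] [NormedSpace ℝ 𝔄]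
  (π : X' → X) (s : J → X ≃ X) (s' : J → X' ≃ X') (N : ℕ)

variable {π s s' N}

/-- Component 2 under the block-translation law: `Ā_μ(s_μ⁻¹ y) = blockAvgV (A′_μ ∘ (s′_μ^N)⁻¹) y`. [folklore] -/
theorem v1C_snd_apply (hblk : ∀ μ x', π ((s' μ ^ N) x') = s μ (π x')) (η : ℝ) (A' : J → X' → 𝔄) (μ : J) (y : X) :
    (v1fieldsOfGauge 𝔄 J s η (gavgM 𝔄 J π A')).2.1 μ y = blockAvgV π (fun x' => A' μ ((s' μ ^ N).symm x')) y := by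
  show blockAvgV π (A' μ) ((s μ).symm y) = _
  exact blockAvgV_translate π (s' μ ^ N) (s μ) (hblk μ) (A' μ) y

/-- **COMPONENT 2 IS CLOSE**: `‖mean(A′_μ∘s′_μ⁻¹)(y) − Ā_μ(s_μ⁻¹y)‖ ≤ (N+1)·rη′` from the first-difference letter `‖A′_μ(z) − A′_μ(s′_μ⁻¹z)‖ ≤ rη′`. [folklore] -/
theorem v1C_snd_sub_le (hblk : ∀ μ x', π ((s' μ ^ N) x') = s μ (π x')) {η η' r : ℝ} (hr : 0 ≤ r) (hη' : 0 ≤ η') {A' : J → X' → 𝔄}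
    (hback : ∀ μ z, ‖A' μ z - A' μ ((s' μ).symm z)‖ ≤ r * η') (μ : J) (y : X) :
    ‖(v1avg 𝔄 J π (v1fieldsOfGauge 𝔄 J s' η' A')).2.1 μ y - (v1fieldsOfGauge 𝔄 J s η (gavgM 𝔄 J π A')).2.1 μ y‖ ≤ (N + 1) * (r * η') := by
  rw [v1C_snd_apply 𝔄 hblk]
  show ‖blockAvgV π (fun x' => A' μ ((s' μ).symm x')) y - blockAvgV π (fun x' => A' μ ((s' μ ^ N).symm x')) y‖ ≤ _
  rw [← blockAvgV_sub']
  refine norm_blockAvgV_le π (by positivity) (fun x' => ?_) y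
  have h1 : ‖A' μ ((s' μ).symm x') - A' μ x'‖ ≤ r * η' := by rw [norm_sub_rev]; exact hback μ x'
  have h2 := norm_powSymm_sub_le (s' μ) (f := A' μ) (fun z => by rw [norm_sub_rev]; exact hback μ z) N x'
  calc ‖A' μ ((s' μ).symm x') - A' μ ((s' μ ^ N).symm x')‖
      ≤ ‖A' μ ((s' μ).symm x') - A' μ x'‖ + ‖A' μ x' - A' μ ((s' μ ^ N).symm x')‖ := norm_sub_le_norm_sub_add_norm_sub _ _ _
    _ ≤ r * η' + N * (r * η') := add_le_add h1 (by rw [norm_sub_rev]; exact h2)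
    _ = (N + 1) * (r * η') := by ring

/-- The coarse divergence at a point: `(∇*Ā)(y) = blockAvgV (x′ ↦ Σ_μ η⁻¹(A′_μ x′ − A′_μ((s′_μ^N)⁻¹x′))) y`. [folklore] -/
theorem v1C_div_apply (hblk : ∀ μ x', π ((s' μ ^ N) x') = s μ (π x')) (η : ℝ) (A' : J → X' → 𝔄) (y : X) :
    (v1fieldsOfGauge 𝔄 J s η (gavgM 𝔄 J π A')).2.2 y = blockAvgV π (fun x' => ∑ μ, η⁻¹ • (A' μ x' - A' μ ((s' μ ^ N).symm x'))) y := by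
  show ∑ μ, η⁻¹ • (blockAvgV π (A' μ) y - blockAvgV π (A' μ) ((s μ).symm y)) = _
  rw [blockAvgV_finsum]
  refine Finset.sum_congr rfl fun μ _ => ?_
  rw [blockAvgV_smul', blockAvgV_sub', blockAvgV_translate π (s' μ ^ N) (s μ) (hblk μ) (A' μ) y]

/-- **COMPONENT 3 IS CLOSE**: `‖mean(∇′*A′)(y) − (∇*Ā)(y)‖ ≤ |J|·rη` when `η = Nη′ > 0`, from the second-difference letter (per-step variation `rη′²` of the backward
difference; `N` backward quotients averaged against the first one). [folklore] -/
theorem v1C_div_sub_le (hblk : ∀ μ x', π ((s' μ ^ N) x') = s μ (π x')) {η η' r : ℝ} (hr : 0 ≤ r) (hη' : 0 < η') (hN : η = N * η')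
    (hη : 0 < η) {A' : J → X' → 𝔄}
    (hsec : ∀ μ z, ‖(A' μ z - A' μ ((s' μ).symm z)) - (A' μ ((s' μ).symm z) - A' μ ((s' μ).symm ((s' μ).symm z)))‖ ≤ r * η' * η') (y : X) :
    ‖(v1avg 𝔄 J π (v1fieldsOfGauge 𝔄 J s' η' A')).2.2 y - (v1fieldsOfGauge 𝔄 J s η (gavgM 𝔄 J π A')).2.2 y‖ ≤ Fintype.card J * (r * η) := by
  rw [v1C_div_apply 𝔄 hblk]
  show ‖blockAvgV π (fun x' => ∑ μ, η'⁻¹ • (A' μ x' - A' μ ((s' μ).symm x'))) y -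
      blockAvgV π (fun x' => ∑ μ, η⁻¹ • (A' μ x' - A' μ ((s' μ ^ N).symm x'))) y‖ ≤ _
  rw [← blockAvgV_sub']
  refine norm_blockAvgV_le π (by positivity) (fun x' => ?_) y
  rw [← Finset.sum_sub_distrib]
  calc ‖∑ μ, (η'⁻¹ • (A' μ x' - A' μ ((s' μ).symm x')) - η⁻¹ • (A' μ x' - A' μ ((s' μ ^ N).symm x')))‖
      ≤ ∑ μ, ‖η'⁻¹ • (A' μ x' - A' μ ((s' μ).symm x')) - η⁻¹ • (A' μ x' - A' μ ((s' μ ^ N).symm x'))‖ := norm_sum_le _ _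
    _ ≤ ∑ _μ : J, r * η := Finset.sum_le_sum fun μ _ => by
        have hNpos : (0 : ℝ) < N := by
          rcases Nat.eq_zero_or_pos N with h0 | hpos
          · exfalso; rw [hN, h0] at hη; simp at hη
          · exact_mod_cast hpos
        have hNη : η'⁻¹ = η⁻¹ * N := by rw [hN]; field_simp
        have key := norm_powSymm_sub_nsmul_le (s' μ) (f := A' μ) (β₂ := r * η' * η') (by positivity) (hsec μ) N x'
        have hrew : η'⁻¹ • (A' μ x' - A' μ ((s' μ).symm x')) - η⁻¹ • (A' μ x' - A' μ ((s' μ ^ N).symm x')) =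
            -(η⁻¹ • ((A' μ x' - A' μ ((s' μ ^ N).symm x')) - (N : ℝ) • (A' μ x' - A' μ ((s' μ).symm x')))) := by
          rw [hNη, mul_smul]; simp only [smul_sub]; abel
        rw [hrew, norm_neg, norm_smul, Real.norm_eq_abs, abs_of_nonneg (inv_nonneg.2 hη.le)]
        calc η⁻¹ * ‖(A' μ x' - A' μ ((s' μ ^ N).symm x')) - (N : ℝ) • (A' μ x' - A' μ ((s' μ).symm x'))‖
            ≤ η⁻¹ * ((N : ℝ) * N * (r * η' * η')) := mul_le_mul_of_nonneg_left key (inv_nonneg.2 hη.le)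
          _ = r * η := by rw [hN]; field_simp
    _ = Fintype.card J * (r * η) := by rw [Finset.sum_const, Finset.card_univ, nsmul_eq_mul]

/-- Sup of component 2 of the coarse triple: `‖Ā_μ(s_μ⁻¹y)‖ ≤ r`. [folklore] -/
theorem v1C_sup_snd_le {η r : ℝ} (hr : 0 ≤ r) {A' : J → X' → 𝔄} (hsup : ∀ μ z, ‖A' μ z‖ ≤ r) (μ : J) (y : X) :
    ‖(v1fieldsOfGauge 𝔄 J s η (gavgM 𝔄 J π A')).2.1 μ y‖ ≤ r :=
  norm_blockAvgV_le π hr (hsup μ) _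

/-- Sup of the coarse divergence: `‖(∇*Ā)(y)‖ ≤ |J|·r` when `η = Nη′ > 0` (each coarse backward quotient is the mean of `N` fine ones of size `≤ r`). [folklore] -/
theorem v1C_sup_div_le (hblk : ∀ μ x', π ((s' μ ^ N) x') = s μ (π x')) {η η' r : ℝ} (hr : 0 ≤ r) (hη' : 0 < η') (hN : η = N * η') (hη : 0 < η)
    {A' : J → X' → 𝔄} (hback : ∀ μ z, ‖A' μ z - A' μ ((s' μ).symm z)‖ ≤ r * η') (y : X) :
    ‖(v1fieldsOfGauge 𝔄 J s η (gavgM 𝔄 J π A')).2.2 y‖ ≤ Fintype.card J * r := by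
  rw [v1C_div_apply 𝔄 hblk]
  refine norm_blockAvgV_le π (by positivity) (fun x' => ?_) y
  calc ‖∑ μ, η⁻¹ • (A' μ x' - A' μ ((s' μ ^ N).symm x'))‖ ≤ ∑ μ, ‖η⁻¹ • (A' μ x' - A' μ ((s' μ ^ N).symm x'))‖ := norm_sum_le _ _
    _ ≤ ∑ _μ : J, r := Finset.sum_le_sum fun μ _ => by
        have hN0 : (N : ℝ) ≠ 0 := fun h0 => hη.ne' (by rw [hN, h0, zero_mul])
        rw [norm_smul, Real.norm_eq_abs, abs_of_nonneg (inv_nonneg.2 hη.le), norm_sub_rev]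
        calc η⁻¹ * ‖A' μ ((s' μ ^ N).symm x') - A' μ x'‖ ≤ η⁻¹ * (N * (r * η')) :=
              mul_le_mul_of_nonneg_left (norm_powSymm_sub_le (s' μ) (fun z => by rw [norm_sub_rev]; exact hback μ z) N x') (inv_nonneg.2 hη.le)
          _ = r := by rw [hN]; field_simp
    _ = Fintype.card J * r := by rw [Finset.sum_const, Finset.card_univ, nsmul_eq_mul]

end Triple

/-! ## §3 V1b's three perturbation letters with the coarse coefficients at the derived triple of the mean field -/

section Letters

variable {X X' J ι : Type} [Fintype X] [Fintype X'] [Fintype J] [Fintype ι] [DecidableEq X] [DecidableEq ι] {𝔄 : Type} [NormedRing 𝔄]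
  [NormedAlgebra ℝ 𝔄] [CompleteSpace 𝔄] (e : 𝔄 ≃L[ℝ] (ι → ℝ)) {g : B6.Geometry} (blk : X → g.Site) (π : X' → X)

/-- Numeric bookkeeping for the one letter `r₂ = 16e(1+|J|)κ_e·ρ` (context-free, so that `nlinarith` stays cheap). [folklore] -/
private theorem r₂_aux {E J κ ρ θ : ℝ} (hE : 0 ≤ E) (hJ : 1 ≤ J) (hκ : 0 ≤ κ) (hρ : 0 ≤ ρ) (hθ : 0 ≤ θ) :
    4 * E * J * κ * ρ ≤ 16 * E * J * κ * ρ ∧ 4 * E * κ * ρ ≤ 16 * E * J * κ * ρ ∧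
      12 * E * J * κ * (ρ * θ) ≤ 16 * E * J * κ * ρ * θ ∧ 10 * E * κ * (ρ * θ) ≤ 16 * E * J * κ * ρ * θ := by
  have h0 : 0 ≤ E * κ * ρ := by positivity
  have h1 : 0 ≤ E * κ * ρ * θ := by positivity
  have hJ0 : 0 ≤ J - 1 := by linarith
  refine ⟨by nlinarith [mul_nonneg h0 hJ0], by nlinarith [mul_nonneg h0 hJ0], by nlinarith [mul_nonneg h1 hJ0], by nlinarith [mul_nonneg h1 hJ0]⟩

/-- **THE THREE PERTURBATION LETTERS OF `V′₁(A)` WITH THE COARSE SIDE AT THE MEAN FIELD's OWN TRIPLE.**  Data: coarse∕fine unit shifts `s`, `s′` (fine ones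
commuting), `C_π`-step-connected pairing fibres, the BLOCK-TRANSLATION LAW `π((s′_μ)^N x′) = s_μ(πx′)`, spacings `0 < η′ ≤ η ≤ 1`, `η = Nη′ ≤ θ`; the C² letters
`(v1GaugeBg s′ η′ M).Reg335 c α₀ A′`; constants `(2+|J|)c ≤ c′`, `(1+|J|)C_π·cMα₀·η′ ≤ c′Mα₀θ`, guard `M ≥ 1`, `α₀ > 0`, `Mα₀ ≤ a₀`, `2·(2c′)·a₀ ≤ 1`.  With
`r₂ = 16e(1+|J|)κ_e·((2c′)Mα₀)`: the unstacked coefficient perturbations — fine `(v1coefC e η′ U′, v1coefA e η′ U′)` at `U′ = (A′, A′∘s′⁻¹, ∇′*A′)`, COARSE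
`(v1coefC e η U_c, v1coefA e η U_c)` at `U_c = (Ā, Ā∘s⁻¹, ∇*Ā)`, `Ā = gavgM π A′` — have majorants `diagK(r₂(1+|J⊕J|))` and diagonal η-defect `diagK(r₂θ(1+|J⊕J|))`;
`0 ≤ r₂ ≤ 16e(1+|J|)κ_e·(2c′)·a₀`. [cite: Balaban1985BackgroundPropagators, Thm 3.1 p.397 (quantifier template); (3.35)–(3.36) p.396, (3.52) p.400 (shapes)] -/
theorem v1C_letters_of_gauge {s : J → X ≃ X} {s' : J → X' ≃ X'} {N : ℕ} {η η' θ c c' a₀ M α₀ Cπ : ℝ}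
    (hcomm : ∀ μ κ x, (s' μ).symm (s' κ x) = s' κ ((s' μ).symm x)) (hCπ : 0 ≤ Cπ)
    (hconn : ∀ (f : X' → 𝔄) (β : ℝ), (∀ κ x, ‖f (s' κ x) - f x‖ ≤ β) → ∀ x₁ x₂, π x₁ = π x₂ → ‖f x₁ - f x₂‖ ≤ Cπ * β)
    (hblk : ∀ μ x', π ((s' μ ^ N) x') = s μ (π x')) (hη' : 0 < η') (hη'η : η' ≤ η) (hη1 : η ≤ 1) (hηθ : η ≤ θ) (hN : η = N * η')
    (hc : 0 ≤ c) (hcc' : (2 + Fintype.card J) * c ≤ c') (hθ' : (1 + Fintype.card J) * Cπ * (c * M * α₀) * η' ≤ c' * M * α₀ * θ)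
    (hM : 1 ≤ M) (hα₀ : 0 < α₀) (hMα : M * α₀ ≤ a₀) (ha₀1 : 2 * (2 * c' * a₀) ≤ 1)
    {A' : J → X' → 𝔄} (hreg : (v1GaugeBg 𝔄 J s' η' M).Reg335 c α₀ A') :
    0 ≤ 16 * Real.exp 1 * (1 + Fintype.card J) * basisConst e * (2 * c' * M * α₀) ∧
      16 * Real.exp 1 * (1 + Fintype.card J) * basisConst e * (2 * c' * M * α₀) ≤
        16 * Real.exp 1 * (1 + Fintype.card J) * basisConst e * (2 * c') * a₀ ∧
      HasMaj (BlockNorm.ofBlocks g (blkPair (liftBlk blk ι))) (BlockNorm.ofBlocks g (liftBlk blk ι))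
        (unstackM (v1coefC e η (v1fieldsOfGauge 𝔄 J s η (gavgM 𝔄 J π A'))) (v1coefA e η (v1fieldsOfGauge 𝔄 J s η (gavgM 𝔄 J π A'))))
        (diagK fun _ => 16 * Real.exp 1 * (1 + Fintype.card J) * basisConst e * (2 * c' * M * α₀) * (1 + Fintype.card (J ⊕ J))) ∧
      HasMaj (BlockNorm.ofBlocks g (blkPair (liftBlk (blk ∘ π) ι))) (BlockNorm.ofBlocks g (liftBlk (blk ∘ π) ι))
        (unstackM (v1coefC e η' (v1fieldsOfGauge 𝔄 J s' η' A')) (v1coefA e η' (v1fieldsOfGauge 𝔄 J s' η' A')))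
        (diagK fun _ => 16 * Real.exp 1 * (1 + Fintype.card J) * basisConst e * (2 * c' * M * α₀) * (1 + Fintype.card (J ⊕ J))) ∧
      HasMaj (BlockNorm.ofBlocks g (blkPair (liftBlk blk ι))) (BlockNorm.ofBlocks g (liftBlk (blk ∘ π) ι))
        (idef (pull (liftPair (liftMap π ι))) (pull (liftMap π ι))
          (unstackM (v1coefC e η' (v1fieldsOfGauge 𝔄 J s' η' A')) (v1coefA e η' (v1fieldsOfGauge 𝔄 J s' η' A')))
          (unstackM (v1coefC e η (v1fieldsOfGauge 𝔄 J s η (gavgM 𝔄 J π A'))) (v1coefA e η (v1fieldsOfGauge 𝔄 J s η (gavgM 𝔄 J π A')))))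
        (diagK fun _ => 16 * Real.exp 1 * (1 + Fintype.card J) * basisConst e * (2 * c' * M * α₀) * θ * (1 + Fintype.card (J ⊕ J))) := by
  obtain ⟨h1, h2, h3⟩ := (reg335_v1GaugeBg_iff 𝔄 J s' η' M c α₀ A').1 hreg
  set U' := v1fieldsOfGauge 𝔄 J s' η' A' with hU'
  set Uc := v1fieldsOfGauge 𝔄 J s η (gavgM 𝔄 J π A') with hUc
  set r : ℝ := c * M * α₀ with hr_def
  set r' : ℝ := c' * M * α₀ with hr'_def
  have hJ0 : (0 : ℝ) ≤ Fintype.card J := Nat.cast_nonneg _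
  have hMα0 : 0 ≤ M * α₀ := mul_nonneg (zero_le_one.trans hM) hα₀.le
  have hr0 : 0 ≤ r := mul_nonneg (mul_nonneg hc (zero_le_one.trans hM)) hα₀.le
  have hη'0 : 0 ≤ η' := hη'.le
  have hη0 : 0 < η := lt_of_lt_of_le hη' hη'η
  have hθ0 : 0 ≤ θ := hη0.le.trans hηθ
  -- the effective constants
  have hc'c : (1 + Fintype.card J) * (c * M * α₀) ≤ c' * M * α₀ := by
    have : (1 + Fintype.card J) * c ≤ c' := (mul_le_mul_of_nonneg_right (add_le_add one_le_two le_rfl) hc).trans hcc'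
    calc (1 + Fintype.card J) * (c * M * α₀) = ((1 + Fintype.card J) * c) * (M * α₀) := by ring
      _ ≤ c' * (M * α₀) := mul_le_mul_of_nonneg_right this hMα0
      _ = c' * M * α₀ := by ring
  have hrr' : (2 + Fintype.card J) * r ≤ r' := by
    calc (2 + Fintype.card J) * r = ((2 + Fintype.card J) * c) * (M * α₀) := by rw [hr_def]; ring
      _ ≤ c' * (M * α₀) := mul_le_mul_of_nonneg_right hcc' hMα0
      _ = r' := by rw [hr'_def]; ring
  have hr_r' : r ≤ r' := (le_mul_of_one_le_left hr0 (le_add_of_le_of_nonneg one_le_two hJ0)).trans hrr'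
  have hJr_r' : Fintype.card J * r ≤ r' := (mul_le_mul_of_nonneg_right (le_add_of_nonneg_left zero_le_two) hr0).trans hrr'
  have h2r : 2 * r ≤ r' := (mul_le_mul_of_nonneg_right (le_add_of_nonneg_right hJ0) hr0).trans hrr'
  have hr'0 : 0 ≤ r' := hr0.trans hr_r'
  have hc'0 : 0 ≤ c' := le_trans (mul_nonneg (by positivity) hc) hcc'
  -- V1b's (3.35) letter pair of the fine triple at `c′`
  have hreg' : (v1Bg 𝔄 J π M θ).Reg335 c' α₀ U' := reg335_fields_of_gauge hcomm hCπ hconn hη' hr0 hc'c hθ' hreg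
  obtain ⟨⟨hs₁, hs₂, hs₃⟩, ho₁, ho₂, ho₃⟩ := (reg335_v1Bg_iff 𝔄 J π M θ c' α₀ U').1 hreg'
  clear hreg hreg'
  -- the backward one-step and second differences of `A′`
  have hback : ∀ μ z, ‖A' μ z - A' μ ((s' μ).symm z)‖ ≤ r * η' := fun μ z => by
    have h := h2 μ μ ((s' μ).symm z)
    rwa [Equiv.apply_symm_apply] at h
  have hsec : ∀ μ z, ‖(A' μ z - A' μ ((s' μ).symm z)) - (A' μ ((s' μ).symm z) - A' μ ((s' μ).symm ((s' μ).symm z)))‖ ≤ r * η' * η' :=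
    fun μ z => by
      have h := h3 μ μ ((s' μ).symm z)
      simp only [Equiv.apply_symm_apply] at h
      exact h
  -- working box `ρ = 2r′`: fine and coarse sups, fits = mean fits `r′θ` plus the translation gaps
  set ρ : ℝ := 2 * r' with hρ_def
  have hr'ρ : r' ≤ ρ := by rw [hρ_def]; exact le_mul_of_one_le_left hr'0 one_le_two
  have hρ0 : 0 ≤ ρ := hr'0.trans hr'ρ
  have hρa : ρ ≤ 2 * c' * a₀ := by
    rw [hρ_def, hr'_def]
    calc 2 * (c' * M * α₀) = 2 * c' * (M * α₀) := by ring
      _ ≤ 2 * c' * a₀ := mul_le_mul_of_nonneg_left hMα (by positivity)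
  have hρ2 : 2 * ρ ≤ 1 := (mul_le_mul_of_nonneg_left hρa zero_le_two).trans ha₀1
  have hs₁' : ∀ μ x', ‖U'.1 μ x'‖ ≤ ρ := fun μ x' => (hs₁ μ x').trans hr'ρ
  have hs₂' : ∀ μ x', ‖U'.2.1 μ x'‖ ≤ ρ := fun μ x' => (hs₂ μ x').trans hr'ρ
  have hs₃' : ∀ x', ‖U'.2.2 x'‖ ≤ ρ := fun x' => (hs₃ x').trans hr'ρ
  have hb₁ : ∀ μ x, ‖Uc.1 μ x‖ ≤ ρ := fun μ x => (norm_blockAvgV_le π hr0 (h1 μ) x).trans (hr_r'.trans hr'ρ)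
  have hb₂ : ∀ μ x, ‖Uc.2.1 μ x‖ ≤ ρ := fun μ x => (v1C_sup_snd_le 𝔄 (π := π) (s := s) (η := η) hr0 h1 μ x).trans (hr_r'.trans hr'ρ)
  have hb₃ : ∀ x, ‖Uc.2.2 x‖ ≤ ρ := fun x => (v1C_sup_div_le 𝔄 hblk hr0 hη' hN hη0 hback x).trans (hJr_r'.trans hr'ρ)
  have hf₁ : ∀ μ x', ‖U'.1 μ x' - Uc.1 μ (π x')‖ ≤ ρ * θ := fun μ x' => by
    have := fit_blockAvgV π (Ω := fun _ => r' * θ) (fun x₁' x₂' h => ho₁ μ x₁' x₂' h) x'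
    exact this.trans (mul_le_mul_of_nonneg_right hr'ρ hθ0)
  have hgap₂ : ((N : ℝ) + 1) * (r * η') ≤ r' * θ := by
    have hNη' : (N : ℝ) * (r * η') = r * η := by rw [hN]; ring
    calc ((N : ℝ) + 1) * (r * η') = r * η + r * η' := by rw [add_mul, hNη', one_mul]
      _ ≤ r * θ + r * θ := add_le_add (mul_le_mul_of_nonneg_left hηθ hr0) (mul_le_mul_of_nonneg_left (hη'η.trans hηθ) hr0)
      _ = (2 * r) * θ := by ring
      _ ≤ r' * θ := mul_le_mul_of_nonneg_right h2r hθ0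
  have hf₂ : ∀ μ x', ‖U'.2.1 μ x' - Uc.2.1 μ (π x')‖ ≤ ρ * θ := fun μ x' => by
    have hm : ‖U'.2.1 μ x' - (v1avg 𝔄 J π U').2.1 μ (π x')‖ ≤ r' * θ :=
      fit_blockAvgV π (Ω := fun _ => r' * θ) (fun x₁' x₂' h => ho₂ μ x₁' x₂' h) x'
    have hg : ‖(v1avg 𝔄 J π U').2.1 μ (π x') - Uc.2.1 μ (π x')‖ ≤ (N + 1) * (r * η') :=
      v1C_snd_sub_le 𝔄 hblk hr0 hη'0 hback μ (π x')
    calc ‖U'.2.1 μ x' - Uc.2.1 μ (π x')‖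
        ≤ ‖U'.2.1 μ x' - (v1avg 𝔄 J π U').2.1 μ (π x')‖ + ‖(v1avg 𝔄 J π U').2.1 μ (π x') - Uc.2.1 μ (π x')‖ :=
          norm_sub_le_norm_sub_add_norm_sub _ _ _
      _ ≤ r' * θ + r' * θ := add_le_add hm (hg.trans hgap₂)
      _ = ρ * θ := by rw [hρ_def]; ring
  have hgap₃ : Fintype.card J * (r * η) ≤ r' * θ := by
    calc Fintype.card J * (r * η) = (Fintype.card J * r) * η := by ring
      _ ≤ r' * θ := mul_le_mul hJr_r' hηθ hη0.le hr'0
  have hf₃ : ∀ x', ‖U'.2.2 x' - Uc.2.2 (π x')‖ ≤ ρ * θ := fun x' => by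
    have hm : ‖U'.2.2 x' - (v1avg 𝔄 J π U').2.2 (π x')‖ ≤ r' * θ :=
      fit_blockAvgV π (Ω := fun _ => r' * θ) (fun x₁' x₂' h => ho₃ x₁' x₂' h) x'
    have hg : ‖(v1avg 𝔄 J π U').2.2 (π x') - Uc.2.2 (π x')‖ ≤ Fintype.card J * (r * η) :=
      v1C_div_sub_le 𝔄 hblk hr0 hη' hN hη0 hsec (π x')
    calc ‖U'.2.2 x' - Uc.2.2 (π x')‖
        ≤ ‖U'.2.2 x' - (v1avg 𝔄 J π U').2.2 (π x')‖ + ‖(v1avg 𝔄 J π U').2.2 (π x') - Uc.2.2 (π x')‖ :=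
          norm_sub_le_norm_sub_add_norm_sub _ _ _
      _ ≤ r' * θ + r' * θ := add_le_add hm (hg.trans hgap₃)
      _ = ρ * θ := by rw [hρ_def]; ring
  -- the one letter `r₂ = 16e(1+|J|)κ_e ρ`
  have hκ : 0 ≤ basisConst e := basisConst_nonneg e
  have hJ1 : (1 : ℝ) ≤ 1 + Fintype.card J := le_add_of_nonneg_right hJ0
  have hρ_eq : 2 * c' * M * α₀ = ρ := by rw [hρ_def, hr'_def]; ring
  rw [hρ_eq]
  set r₂ : ℝ := 16 * Real.exp 1 * (1 + Fintype.card J) * basisConst e * ρ with hr₂_def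
  have hr₂0 : 0 ≤ r₂ := by positivity
  obtain ⟨hCr, hAr, hCrθ, hArθ⟩ := r₂_aux (Real.exp_nonneg 1) hJ1 hκ hρ0 hθ0
  -- row letters and row fits
  have hc'row : ∀ x' i, ∑ j, |v1coefC e η' U' x' i j| ≤ r₂ := fun x' i =>
    (rowSum_v1coefC_le e hρ0 hρ2 hη'0 (hη'η.trans hη1) hs₁' hs₂' hs₃' x' i).trans hCr
  have ha'row : ∀ jμ x' i, ∑ j, |v1coefA e η' U' jμ x' i j| ≤ r₂ := fun jμ x' i =>
    (rowSum_v1coefA_le e hρ0 hρ2 hη'0 (hη'η.trans hη1) hs₁' hs₂' jμ x' i).trans hAr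
  have hcrow : ∀ x i, ∑ j, |v1coefC e η Uc x i j| ≤ r₂ := fun x i =>
    (rowSum_v1coefC_le e hρ0 hρ2 hη0.le hη1 hb₁ hb₂ hb₃ x i).trans hCr
  have harow : ∀ jμ x i, ∑ j, |v1coefA e η Uc jμ x i j| ≤ r₂ := fun jμ x i =>
    (rowSum_v1coefA_le e hρ0 hρ2 hη0.le hη1 hb₁ hb₂ jμ x i).trans hAr
  have hfc : ∀ x' i, ∑ j, |v1coefC e η' U' x' i j - v1coefC e η Uc (π x') i j| ≤ r₂ * θ := fun x' i =>
    (rowFit_v1coefC e π hρ0 hρ2 hη'0 hη'η hη1 hηθ hs₁' hs₂' hb₁ hb₂ hf₁ hf₂ hf₃ x' i).trans hCrθ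
  have hfa : ∀ jμ x' i, ∑ j, |v1coefA e η' U' jμ x' i j - v1coefA e η Uc jμ (π x') i j| ≤ r₂ * θ := fun jμ x' i =>
    (rowFit_v1coefA e π hρ0 hρ2 hη'0 hη'η hη1 hηθ hs₁' hs₂' hb₁ hb₂ hf₁ hf₂ jμ x' i).trans hArθ
  have hr₂a : r₂ ≤ 16 * Real.exp 1 * (1 + Fintype.card J) * basisConst e * (2 * c') * a₀ := by
    rw [hr₂_def]
    calc 16 * Real.exp 1 * (1 + Fintype.card J) * basisConst e * ρ ≤ 16 * Real.exp 1 * (1 + Fintype.card J) * basisConst e * (2 * c' * a₀) :=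
          mul_le_mul_of_nonneg_left hρa (by positivity)
      _ = _ := by ring
  refine ⟨hr₂0, hr₂a, hasMaj_unstackM blk hr₂0 hcrow harow, hasMaj_unstackM (blk ∘ π) hr₂0 hc'row ha'row, ?_⟩
  exact hasMaj_idef_unstackM blk π (mul_nonneg hr₂0 hθ0) hfc hfa

end Letters

end Summit.QuantumFields.YangMills.BalabanUVNodes.N15.BackgroundLayer
end
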